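import Literature.Analysis.FunctionSpaces.TorusFourierSynthesis
import Literature.Analysis.FunctionSpaces.TorusFourierSeries
import Literature.Analysis.FunctionSpaces.TorusFourierCalculus
import Literature.Analysis.FunctionSpaces.TorusInverseLaplacian
import Mathlib.Analysis.SpecialFunctions.Gaussian.PoissonSummation
import HarnessLib

/-!
# The heat kernel of the flat torus `T^d`: positivity, unit mass, decay to equilibrium

Analysis/FunctionSpaces support file (definitions with proved API; no named facts). The **heat
kernel** of the unit torus `T^d = UnitAddTorus d` is the sum of the Gauss–Weierstrass multiplier
against the characters,

  `p_t(x) = ∑_{k ∈ ℤ^d} e^{-4π²|k|²t} e^{2πik·x}`   (`t > 0`),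

the convolution kernel of the heat semigroup `e^{tΔ}` on `T^d` (Stein 1970, Ch. III §2: the
Gauss–Weierstrass semigroup as the multiplier `e^{-4π²t|ξ|²}`, here in its periodic form;
Grafakos 2014, §3.1–3.3 for absolutely convergent Fourier series on `𝕋ⁿ`). This file provides
what heat-semigroup / subordination arguments on the torus consume (first consumer: the `L^p`
bound for the Riesz potential `|∇|⁻¹P_{≠0}`, `FluidPDE/TorusLpOperatorFactsProofs`):

* `Torus.heatCoeff t k = e^{-4π²|k|²t}` and its summability over `ℤ^d` (`Torus.summable_heatCoeff`),
  monotonicity in `t`, and the uniform exponential decay off the zero mode;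
* `Torus.heatKernelC t` (the complex series) and `Torus.heatKernel t = Re p_t`: continuity, the
  Fourier coefficients `p̂_t(k) = e^{-4π²|k|²t}` (`Torus.mFourierCoeff_heatKernelC`), **positivity**
  (`Torus.heatKernel_pos`), unit mass (`Torus.integral_heatKernel`), the decay bound
  `|p_t(x) - 1| ≤ ∑_k e^{-4π²|k|²t} - 1 ≤ e^{-4π²(t-1)}(∑_k e^{-4π²|k|²} - 1)` (`t ≥ 1`), the two
  `L¹` bounds `∫|p_t - 1| ≤ 2` and `≤ e^{-4π²(t-1)}C`, and joint continuity of `(t, x) ↦ p_t(x)` on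
  `(0, ∞) × T^d`;
* lattice tools: shifted Gaussians are summable over `ℤ` (`Torus.summable_int_exp_neg_mul_sq_sub`),
  and absolutely convergent series over `ℤ^ι` of products factor into products of series
  (`Torus.tsum_pi_eq_prod_tsum`; boxes `[-N,N]^ι` and `Finset.sum_prod_piFinset`).

## Positivity (design note)

Positivity of `p_t` is NOT visible on the series; it is Poisson summation
(`p_t(x) = ∑_{n ∈ ℤ^d} (4πt)^{-d/2} e^{-|x+n|²/4t}`). We obtain it without a `d`-dimensional Poisson
formula: the series over `ℤ^d` factors as `p_t(x) = ∏ᵢ ϑ_t(xᵢ)` with the one-dimensional theta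
series `ϑ_t(y) = ∑_{n ∈ ℤ} e^{-4π²n²t} e^{2πiny}`, and Jacobi's imaginary transformation — Mathlib's
`Complex.tsum_exp_neg_quadratic` (the Gaussian Poisson summation formula) with `a = 4πt`,
`b = iy` — rewrites `ϑ_t(y) = (4πt)^{-1/2} ∑_{n ∈ ℤ} e^{-(n-y)²/4t} > 0`.

## Mathlib / tree search

Mathlib has the characters `UnitAddTorus.mFourier`, coefficients `mFourierCoeff`, the Jacobi theta
function (`jacobiTheta₂`, `Complex.tsum_exp_neg_quadratic`) and the Gaussian heat kernel on `ℝⁿ`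
only inside the tree (`Literature.Analysis.UnboundedOperators.heatKernel`); no heat kernel on
`AddCircle`/`UnitAddTorus` (searched `heatKernel`, `torusHeat`, `theta` in `Analysis/Fourier`).
Tree tools used: `Torus.hasSum_mFourier_smul`, `Torus.continuous_tsum_mFourier_smul`,
`Torus.mFourierCoeff_tsum_mFourier_smul` (`TorusLerayHelmholtzProofs`),
`Torus.summable_pi_prod_of_summable`, `Torus.exists_subset_piFinset` (`TorusFourierSeries`),
`Torus.mFourierCoeff_eq_integral_volume` (`TorusFourierCalculus`, transport to the global `volume`).

## References

* E. M. Stein, *Singular Integrals and Differentiability Properties of Functions*, Princeton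
  (1970), Ch. III §2 (the Gauss–Weierstrass semigroup). [`Stein1971`]
* L. Grafakos, *Classical Fourier Analysis*, 3rd ed., GTM 249 (2014), §3.1.1, Prop. 3.2.5,
  §3.3.1 (Fourier series on `𝕋ⁿ`: the torus, inversion, decay of coefficients). [`Grafakos2014`]
* E. M. Stein, G. Weiss, *Introduction to Fourier Analysis on Euclidean Spaces* (1971), Ch. VII
  §2 (Poisson summation and periodisation). [`SteinWeiss1971`]
-/

noncomputable section

open MeasureTheory Set Filter Function UnitAddTorus
open _root_.Topology
open scoped ENNReal NNReal

namespace Literature.Analysis.FunctionSpaces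

namespace Torus

variable {d : Type*} [Fintype d]

/-! ## Lattice sums: shifted Gaussians over `ℤ`, products over `ℤ^ι` -/

section Lattice

/-- **Shifted Gaussians are summable over `ℤ`**: `∑_{n ∈ ℤ} e^{-c(n-y)²} < ∞` for `c > 0`
(comparison with the two geometric series `e^{-(c/2)|n|}`, using `(n-y)² ≥ n²/2 - y²` and
`|n| ≤ n² + 1`). [folklore] -/
theorem summable_int_exp_neg_mul_sq_sub {c : ℝ} (hc : 0 < c) (y : ℝ) :
    Summable fun n : ℤ => Real.exp (-(c * ((n : ℝ) - y) ^ 2)) := by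
  have hgeo : Summable fun n : ℕ => Real.exp (n * (-(c / 2))) :=
    Real.summable_exp_nat_mul_iff.2 (by linarith)
  have hZ : Summable fun n : ℤ => Real.exp (-(c / 2) * |(n : ℝ)|) := by
    refine Summable.of_nat_of_neg ?_ ?_
    · refine hgeo.congr fun n => ?_
      rw [Int.cast_natCast, Nat.abs_cast]
      ring_nf
    · refine hgeo.congr fun n => ?_
      rw [Int.cast_neg, Int.cast_natCast, abs_neg, Nat.abs_cast]
      ring_nf
  refine Summable.of_nonneg_of_le (fun n => (Real.exp_pos _).le) (fun n => ?_)
    (hZ.mul_left (Real.exp (c * y ^ 2 + c / 2)))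
  rw [← Real.exp_add, Real.exp_le_exp]
  have h1 : |(n : ℝ)| ≤ (n : ℝ) ^ 2 + 1 := abs_intCast_le_sq_add_one n
  have h2 : 0 ≤ c * ((n : ℝ) - 2 * y) ^ 2 := mul_nonneg hc.le (sq_nonneg _)
  have h3 : 0 ≤ c * ((n : ℝ) ^ 2 + 1 - |(n : ℝ)|) := mul_nonneg hc.le (by linarith)
  nlinarith [h2, h3]

/-- The symmetric integer intervals `[-N, N]` exhaust `ℤ` (as a net of finite sets). [folklore] -/
theorem tendsto_Icc_neg_atTop :
    Tendsto (fun N : ℕ => Finset.Icc (-(N : ℤ)) N) atTop atTop := by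
  refine tendsto_atTop_finset_of_monotone (fun M N hMN => ?_) (fun k => ?_)
  · exact Finset.Icc_subset_Icc (by simpa using hMN) (by simpa using hMN)
  · refine ⟨k.natAbs, Finset.mem_Icc.2 ⟨?_, ?_⟩⟩
    · rw [Int.natCast_natAbs]
      exact neg_abs_le k
    · rw [Int.natCast_natAbs]
      exact le_abs_self k

/-- The boxes `[-N, N]^ι` exhaust `ℤ^ι` (as a net of finite sets). [folklore] -/
theorem tendsto_piFinset_Icc_atTop (ι : Type*) [Fintype ι] [DecidableEq ι] :
    Tendsto (fun N : ℕ => Fintype.piFinset fun _ : ι => Finset.Icc (-(N : ℤ)) N) atTop atTop := by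
  refine tendsto_atTop_finset_of_monotone (fun M N hMN => ?_) (fun k => ?_)
  · exact Fintype.piFinset_subset _ _ fun _ =>
      Finset.Icc_subset_Icc (by simpa using hMN) (by simpa using hMN)
  · refine ⟨Finset.univ.sup fun i => (k i).natAbs, Fintype.mem_piFinset.2 fun i => ?_⟩
    have h : (k i).natAbs ≤ Finset.univ.sup fun i => (k i).natAbs :=
      Finset.le_sup (f := fun i => (k i).natAbs) (Finset.mem_univ i)
    have h' : (((k i).natAbs : ℕ) : ℤ) ≤ ((Finset.univ.sup fun i => (k i).natAbs : ℕ) : ℤ) := by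
      exact_mod_cast h
    rw [Int.natCast_natAbs] at h'
    exact Finset.mem_Icc.2 (abs_le.1 h')

/-- **Products of absolutely convergent series over `ℤ^ι`.** If every `g i : ℤ → ℂ` is
absolutely summable then `k ↦ ∏ᵢ g i (k i)` is summable over `ℤ^ι` and
`∑_{k ∈ ℤ^ι} ∏ᵢ g i (kᵢ) = ∏ᵢ ∑_{n ∈ ℤ} g i (n)` (partial sums over the boxes `[-N,N]^ι` factorise,
`Finset.sum_prod_piFinset`, and both sides are their limits). [folklore] -/
theorem tsum_pi_eq_prod_tsum {ι : Type*} [Fintype ι] [DecidableEq ι] {g : ι → ℤ → ℂ}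
    (hg : ∀ i, Summable fun n => ‖g i n‖) :
    (Summable fun k : ι → ℤ => ∏ i, g i (k i)) ∧
      ∑' k : ι → ℤ, ∏ i, g i (k i) = ∏ i, ∑' n, g i n := by
  have hnn : ∀ i n, 0 ≤ ‖g i n‖ := fun _ _ => norm_nonneg _
  have hN : Summable fun k : ι → ℤ => ∏ i, ‖g i (k i)‖ := by
    refine summable_of_sum_le (fun k => Finset.prod_nonneg fun i _ => hnn i _)
      (c := ∏ i, ∑' n, ‖g i n‖) fun u => ?_
    obtain ⟨T, hsub⟩ := exists_subset_piFinset u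
    calc ∑ k ∈ u, ∏ i, ‖g i (k i)‖
        ≤ ∑ k ∈ Fintype.piFinset (fun _ : ι => T), ∏ i, ‖g i (k i)‖ :=
          Finset.sum_le_sum_of_subset_of_nonneg hsub fun k _ _ =>
            Finset.prod_nonneg fun i _ => hnn i _
      _ = ∏ i, ∑ j ∈ T, ‖g i j‖ := Finset.sum_prod_piFinset T fun i j => ‖g i j‖
      _ ≤ ∏ i, ∑' n, ‖g i n‖ :=
          Finset.prod_le_prod (fun i _ => Finset.sum_nonneg fun j _ => hnn i j)
            fun i _ => (hg i).sum_le_tsum T fun j _ => hnn i j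
  have hS : Summable fun k : ι → ℤ => ∏ i, g i (k i) :=
    Summable.of_norm_bounded hN fun k => (norm_prod _ _).le
  refine ⟨hS, ?_⟩
  have h1 : Tendsto (fun N : ℕ => ∑ k ∈ Fintype.piFinset (fun _ : ι => Finset.Icc (-(N : ℤ)) N),
      ∏ i, g i (k i)) atTop (𝓝 (∑' k : ι → ℤ, ∏ i, g i (k i))) :=
    hS.hasSum.comp (tendsto_piFinset_Icc_atTop ι)
  have h2 : Tendsto (fun N : ℕ => ∏ i, ∑ j ∈ Finset.Icc (-(N : ℤ)) N, g i j) atTop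
      (𝓝 (∏ i, ∑' n, g i n)) :=
    tendsto_finsetProd _ fun i _ => (hg i).of_norm.hasSum.comp tendsto_Icc_neg_atTop
  have h3 : (fun N : ℕ => ∑ k ∈ Fintype.piFinset (fun _ : ι => Finset.Icc (-(N : ℤ)) N),
      ∏ i, g i (k i)) = fun N : ℕ => ∏ i, ∑ j ∈ Finset.Icc (-(N : ℤ)) N, g i j :=
    funext fun N => Finset.sum_prod_piFinset _ _
  rw [h3] at h1
  exact tendsto_nhds_unique h1 h2

end Lattice

/-! ## The heat kernel of the torus -/

section HeatKernel

/-- The **heat coefficients** `e^{-4π²|k|²t}`: the symbol of the heat semigroup `e^{tΔ}` on the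
unit torus at the frequency `k ∈ ℤ^d` (the character `e^{2πik·x}` is an eigenfunction of `Δ` with
eigenvalue `-4π²|k|²`). [folklore] -/
def heatCoeff (t : ℝ) (k : d → ℤ) : ℝ :=
  Real.exp (-(4 * Real.pi ^ 2 * freqNormSq k * t))

/-- Unfolding `heatCoeff`. [folklore] -/
theorem heatCoeff_apply (t : ℝ) (k : d → ℤ) :
    heatCoeff t k = Real.exp (-(4 * Real.pi ^ 2 * freqNormSq k * t)) := rfl

/-- The heat coefficients are positive. [folklore] -/
theorem heatCoeff_pos (t : ℝ) (k : d → ℤ) : 0 < heatCoeff t k := Real.exp_pos _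

/-- The zero mode is undamped: `e^{-4π²·0·t} = 1`. [folklore] -/
@[simp]
theorem heatCoeff_zero_right (t : ℝ) : heatCoeff t (0 : d → ℤ) = 1 := by
  simp [heatCoeff, freqNormSq_zero]

/-- The heat coefficients factor over the coordinates: `e^{-4π²|k|²t} = ∏ᵢ e^{-4π²kᵢ²t}`. [folklore] -/
theorem heatCoeff_eq_prod (t : ℝ) (k : d → ℤ) :
    heatCoeff t k = ∏ i, Real.exp (-(4 * Real.pi ^ 2 * t * ((k i : ℝ)) ^ 2)) := by
  rw [heatCoeff, freqNormSq, ← Real.exp_sum]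
  congr 1
  rw [Finset.mul_sum, Finset.sum_mul, ← Finset.sum_neg_distrib]
  refine Finset.sum_congr rfl fun i _ => ?_
  ring

/-- The heat coefficients are summable over `ℤ^d` for `t > 0`. [folklore] -/
theorem summable_heatCoeff {t : ℝ} (ht : 0 < t) : Summable (heatCoeff (d := d) t) := by
  have h1 : Summable fun n : ℤ => Real.exp (-(4 * Real.pi ^ 2 * t * (n : ℝ) ^ 2)) := by
    simpa using summable_int_exp_neg_mul_sq_sub (c := 4 * Real.pi ^ 2 * t) (by positivity) 0
  have h := summable_pi_prod_of_summable (d := d) (fun j => (Real.exp_pos _).le) h1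
  refine h.congr fun k => ?_
  exact (heatCoeff_eq_prod t k).symm

/-- The heat coefficients decrease in time. [folklore] -/
theorem heatCoeff_le_of_le {s t : ℝ} (hst : s ≤ t) (k : d → ℤ) : heatCoeff t k ≤ heatCoeff s k := by
  rw [heatCoeff, heatCoeff, Real.exp_le_exp, neg_le_neg_iff]
  have := freqNormSq_nonneg k
  have : 0 ≤ 4 * Real.pi ^ 2 * freqNormSq k := by positivity
  nlinarith

/-- Off the zero mode the coefficients decay exponentially, uniformly in `k`:
`e^{-4π²|k|²t} ≤ e^{-4π²(t-1)} e^{-4π²|k|²}` for `t ≥ 1`, `k ≠ 0` (`|k|² ≥ 1`). [folklore] -/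
theorem heatCoeff_le_exp_mul {t : ℝ} (ht : 1 ≤ t) {k : d → ℤ} (hk : k ≠ 0) :
    heatCoeff t k ≤ Real.exp (-(4 * Real.pi ^ 2 * (t - 1))) * heatCoeff 1 k := by
  rw [heatCoeff, heatCoeff, ← Real.exp_add, Real.exp_le_exp]
  have h1 := one_le_freqNormSq_of_ne_zero hk
  have hπ : 0 < 4 * Real.pi ^ 2 := by positivity
  have : 0 ≤ 4 * Real.pi ^ 2 * ((t - 1) * (freqNormSq k - 1)) := by
    have : 0 ≤ (t - 1) * (freqNormSq k - 1) := mul_nonneg (by linarith) (by linarith)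
    positivity
  nlinarith

/-- The **complex heat kernel of the torus**, `p_t(x) = ∑_{k ∈ ℤ^d} e^{-4π²|k|²t} e^{2πik·x}`
(absolutely convergent for `t > 0`; Stein 1970, Ch. III §2, the Gauss–Weierstrass kernel, periodic
version; Grafakos 2014, §3.3). Junk (`tsum` convention) for `t ≤ 0`. [folklore] -/
def heatKernelC (t : ℝ) (x : UnitAddTorus d) : ℂ :=
  ∑' k : d → ℤ, mFourier k x • ((heatCoeff t k : ℝ) : ℂ)

/-- The complexified heat coefficients are absolutely summable for `t > 0`. [folklore] -/
theorem summable_norm_ofReal_heatCoeff {t : ℝ} (ht : 0 < t) :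
    Summable fun k : d → ℤ => ‖((heatCoeff t k : ℝ) : ℂ)‖ := by
  refine (summable_heatCoeff ht).congr fun k => ?_
  rw [Complex.norm_real, Real.norm_of_nonneg (heatCoeff_pos t k).le]

/-- The series defining the heat kernel converges. [folklore] -/
theorem hasSum_heatKernelC {t : ℝ} (ht : 0 < t) (x : UnitAddTorus d) :
    HasSum (fun k : d → ℤ => mFourier k x • ((heatCoeff t k : ℝ) : ℂ)) (heatKernelC t x) :=
  hasSum_mFourier_smul (summable_norm_ofReal_heatCoeff ht) x

/-- The heat kernel is continuous for `t > 0`. [folklore] -/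
theorem continuous_heatKernelC {t : ℝ} (ht : 0 < t) : Continuous (heatKernelC (d := d) t) :=
  continuous_tsum_mFourier_smul (summable_norm_ofReal_heatCoeff ht)

/-- **The Fourier coefficients of the heat kernel are the heat coefficients**,
`p̂_t(k) = e^{-4π²|k|²t}`. [folklore] -/
theorem mFourierCoeff_heatKernelC {t : ℝ} (ht : 0 < t) (k : d → ℤ) :
    mFourierCoeff (heatKernelC (d := d) t) k = ((heatCoeff t k : ℝ) : ℂ) :=
  mFourierCoeff_tsum_mFourier_smul (summable_norm_ofReal_heatCoeff ht) k

/-- **Uniform closeness to `1` for large times**: `‖p_t(x) - 1‖ ≤ ∑_{k ≠ 0} e^{-4π²|k|²t}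
= (∑_k e^{-4π²|k|²t}) - 1` (the zero mode of the series is `1`). [folklore] -/
theorem norm_heatKernelC_sub_one_le {t : ℝ} (ht : 0 < t) (x : UnitAddTorus d) :
    ‖heatKernelC t x - 1‖ ≤ (∑' k : d → ℤ, heatCoeff t k) - 1 := by
  classical
  set f : (d → ℤ) → ℂ := fun k => mFourier k x • ((heatCoeff t k : ℝ) : ℂ) with hf
  have hfs : Summable f := (hasSum_heatKernelC ht x).summable
  have hf0 : f 0 = 1 := by simp [hf, mFourier_zero]
  have h1 : heatKernelC t x - 1 = ∑' k, if k = 0 then 0 else f k := by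
    rw [← hf0, (hasSum_heatKernelC ht x).tsum_eq.symm, hfs.tsum_eq_add_tsum_ite 0]
    ring
  have hnorm : ∀ k, ‖(if k = 0 then 0 else f k)‖ = if k = 0 then 0 else heatCoeff t k := by
    intro k
    split_ifs with hk
    · simp
    · rw [hf, norm_smul, norm_mFourier_apply, one_mul, Complex.norm_real,
        Real.norm_of_nonneg (heatCoeff_pos t k).le]
  have hs' : Summable fun k : d → ℤ => if k = 0 then 0 else heatCoeff t k := by
    refine Summable.of_nonneg_of_le (fun k => ?_) (fun k => ?_) (summable_heatCoeff ht)
    · split_ifs <;> [exact le_rfl; exact (heatCoeff_pos t k).le]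
    · split_ifs <;> [exact (heatCoeff_pos t k).le; exact le_rfl]
  have hns : Summable fun k => ‖(if k = 0 then 0 else f k)‖ := hs'.congr fun k => (hnorm k).symm
  have h2 : (∑' k : d → ℤ, heatCoeff t k) - 1 = ∑' k : d → ℤ, if k = 0 then 0 else heatCoeff t k := by
    rw [(summable_heatCoeff ht).tsum_eq_add_tsum_ite 0, heatCoeff_zero_right, add_sub_cancel_left]
  rw [h1, h2]
  refine (norm_tsum_le_tsum_norm hns).trans (le_of_eq (tsum_congr hnorm))

/-- The tail sum `∑_k e^{-4π²|k|²t} - 1 = ∑_{k≠0} e^{-4π²|k|²t}` decays exponentially: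
`≤ e^{-4π²(t-1)} (∑_k e^{-4π²|k|²} - 1)` for `t ≥ 1`. [folklore] -/
theorem tsum_heatCoeff_sub_one_le {t : ℝ} (ht : 1 ≤ t) :
    (∑' k : d → ℤ, heatCoeff t k) - 1 ≤
      Real.exp (-(4 * Real.pi ^ 2 * (t - 1))) * ((∑' k : d → ℤ, heatCoeff 1 k) - 1) := by
  classical
  have ht0 : 0 < t := by linarith
  have hι : ∀ {s : ℝ}, 0 < s → ((∑' k : d → ℤ, heatCoeff s k) - 1 =
      ∑' k : d → ℤ, if k = 0 then 0 else heatCoeff s k) := fun hs => by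
    rw [(summable_heatCoeff hs).tsum_eq_add_tsum_ite 0, heatCoeff_zero_right]
    ring
  have hsum : ∀ {s : ℝ}, 0 < s → Summable fun k : d → ℤ => if k = 0 then 0 else heatCoeff s k :=
    fun hs => Summable.of_nonneg_of_le
      (fun k => by split_ifs <;> [exact le_rfl; exact (heatCoeff_pos _ k).le])
      (fun k => by split_ifs <;> [exact (heatCoeff_pos _ k).le; exact le_rfl]) (summable_heatCoeff hs)
  rw [hι ht0, hι one_pos, ← tsum_mul_left]
  refine Summable.tsum_le_tsum (fun k => ?_) (hsum ht0) ((hsum one_pos).mul_left _)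
  split_ifs with hk
  · simp
  · exact heatCoeff_le_exp_mul ht hk

/-- The nonnegative tail sum. [folklore] -/
theorem one_le_tsum_heatCoeff {t : ℝ} (ht : 0 < t) : 1 ≤ ∑' k : d → ℤ, heatCoeff t k := by
  classical
  rw [(summable_heatCoeff ht).tsum_eq_add_tsum_ite 0, heatCoeff_zero_right]
  have : 0 ≤ ∑' k : d → ℤ, if k = 0 then 0 else heatCoeff t k :=
    tsum_nonneg fun k => by split_ifs <;> [exact le_rfl; exact (heatCoeff_pos t k).le]
  linarith

/-! ### Positivity: product structure and Jacobi's imaginary transformation -/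

/-- **The one-dimensional theta function is positive**: for `t > 0` and real `y`,
`∑_{n ∈ ℤ} e^{2πiny} e^{-4π²n²t} = (4πt)^{-1/2} ∑_{n ∈ ℤ} e^{-(n-y)²/(4t)}` is a positive real
number (Jacobi's imaginary transformation = Poisson summation for the Gaussian, Mathlib's
`Complex.tsum_exp_neg_quadratic` with `a = 4πt`, `b = iy`). [folklore] -/
theorem exists_pos_tsum_fourier_mul_exp {t : ℝ} (ht : 0 < t) (y : ℝ) :
    ∃ R : ℝ, 0 < R ∧ (∑' n : ℤ, fourier n (y : UnitAddCircle) *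
      ((Real.exp (-(4 * Real.pi ^ 2 * t * (n : ℝ) ^ 2)) : ℝ) : ℂ)) = (R : ℂ) := by
  set a : ℂ := ((4 * Real.pi * t : ℝ) : ℂ) with ha_def
  set b : ℂ := Complex.I * (y : ℂ) with hb_def
  have hat : 0 < 4 * Real.pi * t := by positivity
  have ha : 0 < a.re := by rw [ha_def, Complex.ofReal_re]; exact hat
  have hterm : ∀ n : ℤ, fourier n (y : UnitAddCircle) *
      ((Real.exp (-(4 * Real.pi ^ 2 * t * (n : ℝ) ^ 2)) : ℝ) : ℂ) =
      Complex.exp (-Real.pi * a * (n : ℂ) ^ 2 + 2 * Real.pi * b * n) := by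
    intro n
    rw [fourier_coe_apply, Complex.ofReal_exp, ← Complex.exp_add]
    congr 1
    rw [ha_def, hb_def]
    push_cast
    ring
  rw [tsum_congr hterm, Complex.tsum_exp_neg_quadratic ha b]
  -- the transformed series is a series of positive reals
  set c : ℝ := Real.pi / (4 * Real.pi * t) with hc_def
  have hc : 0 < c := by positivity
  have hterm' : ∀ n : ℤ, Complex.exp (-Real.pi / a * ((n : ℂ) + Complex.I * b) ^ 2) =
      ((Real.exp (-(c * ((n : ℝ) - y) ^ 2)) : ℝ) : ℂ) := by
    intro n
    have hb2 : (n : ℂ) + Complex.I * b = (((n : ℝ) - y : ℝ) : ℂ) := by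
      rw [hb_def, ← mul_assoc, Complex.I_mul_I]
      push_cast
      ring
    rw [hb2, ha_def, Complex.ofReal_exp]
    congr 1
    simp only [hc_def]
    push_cast
    ring
  have hpow : (1 : ℂ) / a ^ (1 / 2 : ℂ) = (((1 : ℝ) / (4 * Real.pi * t) ^ (1 / 2 : ℝ) : ℝ) : ℂ) := by
    rw [Complex.ofReal_div, Complex.ofReal_one, Complex.ofReal_cpow hat.le, ha_def]
    norm_num
  rw [tsum_congr hterm', ← Complex.ofReal_tsum, hpow, ← Complex.ofReal_mul]
  refine ⟨_, mul_pos (div_pos one_pos (Real.rpow_pos_of_pos hat _)) ?_, rfl⟩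
  exact (summable_int_exp_neg_mul_sq_sub hc y).tsum_pos (fun n => (Real.exp_pos _).le) 0
    (Real.exp_pos _)

/-- **Product structure of the heat kernel**: `p_t(x) = ∏ᵢ ϑ_t(xᵢ)` with the one-dimensional
theta series `ϑ_t(z) = ∑_{n ∈ ℤ} e^{2πinz} e^{-4π²n²t}` (the character `e_k(x) = ∏ᵢ e^{2πikᵢxᵢ}` and
the coefficient `e^{-4π²|k|²t} = ∏ᵢ e^{-4π²kᵢ²t}` factor, and the absolutely convergent series
over `ℤ^d` is the product of the coordinate series, `tsum_pi_eq_prod_tsum`). [folklore] -/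
theorem heatKernelC_eq_prod [DecidableEq d] {t : ℝ} (ht : 0 < t) (x : UnitAddTorus d) :
    heatKernelC t x = ∏ i, ∑' n : ℤ, fourier n (x i) *
      ((Real.exp (-(4 * Real.pi ^ 2 * t * (n : ℝ) ^ 2)) : ℝ) : ℂ) := by
  have hg : ∀ i : d, Summable fun n : ℤ => ‖fourier n (x i) *
      ((Real.exp (-(4 * Real.pi ^ 2 * t * (n : ℝ) ^ 2)) : ℝ) : ℂ)‖ := by
    intro i
    have h1 : Summable fun n : ℤ => Real.exp (-(4 * Real.pi ^ 2 * t * (n : ℝ) ^ 2)) := by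
      simpa using summable_int_exp_neg_mul_sq_sub (c := 4 * Real.pi ^ 2 * t) (by positivity) 0
    refine h1.congr fun n => ?_
    rw [norm_mul, Complex.norm_real, Real.norm_of_nonneg (Real.exp_pos _).le, fourier_apply,
      Circle.norm_coe, one_mul]
  rw [← (tsum_pi_eq_prod_tsum hg).2, heatKernelC]
  refine tsum_congr fun k => ?_
  rw [smul_eq_mul, heatCoeff_eq_prod, Complex.ofReal_prod,
    show (mFourier k x : ℂ) = ∏ i, fourier (k i) (x i) from rfl, ← Finset.prod_mul_distrib]

/-- **Positivity of the heat kernel**: for `t > 0` and every `x`, `p_t(x)` is a positive real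
number (product of positive one-dimensional theta values). [folklore] -/
theorem exists_pos_heatKernelC_eq {t : ℝ} (ht : 0 < t) (x : UnitAddTorus d) :
    ∃ r : ℝ, 0 < r ∧ heatKernelC t x = (r : ℂ) := by
  classical
  have h : ∀ i : d, ∃ R : ℝ, 0 < R ∧ (∑' n : ℤ, fourier n (x i) *
      ((Real.exp (-(4 * Real.pi ^ 2 * t * (n : ℝ) ^ 2)) : ℝ) : ℂ)) = (R : ℂ) := by
    intro i
    obtain ⟨y, hy⟩ := QuotientAddGroup.mk_surjective (x i)
    rw [← hy]
    exact exists_pos_tsum_fourier_mul_exp ht y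
  choose R hR using h
  refine ⟨∏ i, R i, Finset.prod_pos fun i _ => (hR i).1, ?_⟩
  rw [heatKernelC_eq_prod ht x, Complex.ofReal_prod]
  exact Finset.prod_congr rfl fun i _ => (hR i).2

/-- The **heat kernel of the torus** as a real function, `p_t(x) = Re ∑_k e^{-4π²|k|²t}e^{2πik·x}`
(the series is real, indeed positive, `exists_pos_heatKernelC_eq`). [folklore] -/
def heatKernel (t : ℝ) (x : UnitAddTorus d) : ℝ :=
  (heatKernelC t x).re

/-- For `t > 0` the complex heat kernel is the complexification of the real one. [folklore] -/
theorem ofReal_heatKernel {t : ℝ} (ht : 0 < t) (x : UnitAddTorus d) :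
    ((heatKernel t x : ℝ) : ℂ) = heatKernelC t x := by
  obtain ⟨r, -, hr⟩ := exists_pos_heatKernelC_eq ht x
  rw [heatKernel, hr, Complex.ofReal_re]

/-- **The heat kernel is positive.** [folklore] -/
theorem heatKernel_pos {t : ℝ} (ht : 0 < t) (x : UnitAddTorus d) : 0 < heatKernel t x := by
  obtain ⟨r, hr, h⟩ := exists_pos_heatKernelC_eq ht x
  rwa [heatKernel, h, Complex.ofReal_re]

/-- The heat kernel is continuous for `t > 0`. [folklore] -/
theorem continuous_heatKernel {t : ℝ} (ht : 0 < t) : Continuous (heatKernel (d := d) t) :=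
  Complex.continuous_re.comp (continuous_heatKernelC ht)

/-- **Unit mass**: `∫_{T^d} p_t = 1` (the zeroth Fourier coefficient). [folklore] -/
theorem integral_heatKernel {t : ℝ} (ht : 0 < t) : ∫ x, heatKernel (d := d) t x = 1 := by
  have h := mFourierCoeff_heatKernelC (d := d) ht 0
  rw [heatCoeff_zero_right, Complex.ofReal_one, mFourierCoeff_eq_integral_volume] at h
  simp only [neg_zero, mFourier_zero, ContinuousMap.one_apply, one_smul] at h
  have h2 : ∫ x, ((heatKernel (d := d) t x : ℝ) : ℂ) = 1 := by
    rw [← h]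
    congr 1
    funext x
    exact ofReal_heatKernel ht x
  rw [integral_complex_ofReal] at h2
  exact_mod_cast h2

/-- `|p_t(x) - 1| ≤ ∑_k e^{-4π²|k|²t} - 1`. [folklore] -/
theorem abs_heatKernel_sub_one_le {t : ℝ} (ht : 0 < t) (x : UnitAddTorus d) :
    |heatKernel t x - 1| ≤ (∑' k : d → ℤ, heatCoeff t k) - 1 := by
  have h := norm_heatKernelC_sub_one_le ht x
  rwa [← ofReal_heatKernel ht x, ← Complex.ofReal_one, ← Complex.ofReal_sub, Complex.norm_real,
    Real.norm_eq_abs] at h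

/-- **First `L¹` bound**: `∫|p_t - 1| ≤ 2` (positivity and unit mass). [folklore] -/
theorem integral_abs_heatKernel_sub_one_le_two {t : ℝ} (ht : 0 < t) :
    ∫ x, |heatKernel (d := d) t x - 1| ≤ 2 := by
  have hint : Integrable (heatKernel (d := d) t) volume := (continuous_heatKernel ht).integrable_unitAddTorus
  calc ∫ x, |heatKernel (d := d) t x - 1| ≤ ∫ x, (heatKernel (d := d) t x + 1) := by
        refine integral_mono ((hint.sub (integrable_const 1)).abs) (hint.add (integrable_const 1))
          fun x => ?_
        have := heatKernel_pos ht x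
        simp only
        rw [abs_le]
        constructor <;> linarith
    _ = 2 := by
        rw [integral_add hint (integrable_const 1), integral_heatKernel ht]
        simp
        norm_num

/-- **Second `L¹` bound**: `∫|p_t - 1| ≤ e^{-4π²(t-1)} (∑_k e^{-4π²|k|²} - 1)` for `t ≥ 1`. [folklore] -/
theorem integral_abs_heatKernel_sub_one_le_exp {t : ℝ} (ht : 1 ≤ t) :
    ∫ x, |heatKernel (d := d) t x - 1| ≤
      Real.exp (-(4 * Real.pi ^ 2 * (t - 1))) * ((∑' k : d → ℤ, heatCoeff 1 k) - 1) := by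
  have ht0 : 0 < t := by linarith
  calc ∫ x, |heatKernel (d := d) t x - 1| ≤ ∫ _x : UnitAddTorus d, ((∑' k : d → ℤ, heatCoeff t k) - 1) := by
        refine integral_mono_of_nonneg (ae_of_all _ fun x => abs_nonneg _) (integrable_const _)
          (ae_of_all _ fun x => abs_heatKernel_sub_one_le ht0 x)
    _ = (∑' k : d → ℤ, heatCoeff t k) - 1 := by simp
    _ ≤ _ := tsum_heatCoeff_sub_one_le ht

/-- **Joint continuity** of `(t, x) ↦ p_t(x)` on `(0, ∞) × T^d` (locally uniform convergence:
on `t ≥ ε` the terms are dominated by `e^{-4π²|k|²ε}`). [folklore] -/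
theorem continuousOn_heatKernelC_uncurry :
    ContinuousOn (fun z : ℝ × UnitAddTorus d => heatKernelC z.1 z.2) (Ioi 0 ×ˢ univ) := by
  intro z hz
  have hz1 : 0 < z.1 := (mem_prod.1 hz).1
  have hε : 0 < z.1 / 2 := by linarith
  have hcont : ContinuousOn (fun w : ℝ × UnitAddTorus d => heatKernelC w.1 w.2) (Ici (z.1 / 2) ×ˢ univ) := by
    refine continuousOn_tsum (fun k => ?_) (summable_heatCoeff (d := d) hε) fun k w hw => ?_
    · refine Continuous.continuousOn ?_
      refine ((mFourier k).continuous.comp continuous_snd).smul ?_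
      exact Complex.continuous_ofReal.comp (Real.continuous_exp.comp
        ((continuous_const.mul continuous_fst).neg))
    · have hw1 : z.1 / 2 ≤ w.1 := (mem_prod.1 hw).1
      rw [norm_smul, norm_mFourier_apply, one_mul, Complex.norm_real,
        Real.norm_of_nonneg (heatCoeff_pos _ k).le]
      exact heatCoeff_le_of_le hw1 k
  have hmem : Ici (z.1 / 2) ×ˢ (univ : Set (UnitAddTorus d)) ∈ 𝓝 z := by
    refine prod_mem_nhds (Ici_mem_nhds (by linarith)) univ_mem
  exact (hcont.continuousAt hmem).continuousWithinAt

/-- Joint continuity of the real heat kernel on `(0, ∞) × T^d`. [folklore] -/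
theorem continuousOn_heatKernel_uncurry :
    ContinuousOn (fun z : ℝ × UnitAddTorus d => heatKernel z.1 z.2) (Ioi 0 ×ˢ univ) :=
  Complex.continuous_re.comp_continuousOn continuousOn_heatKernelC_uncurry

end HeatKernel

end Torus

end Literature.Analysis.FunctionSpaces
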